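import Summits.Schanuel.Schanuel.Theorems.RootDecomp1KSectorTheorem07

/-!
# RootDecomp1KSectorTheorem — lens 1, generation 67, NODE 27 «THE SECTOR THEOREM BY ONE NEWTON STEP AT (∞,∞) — THE EDGE ENGINE» — FORK (B): the FIRST-ORDER SECTOR THEOREM at FLOOR F (`thinFibreAt_of_sectorCond : c k ≠ 0 → DomZero k c → SectorCond m₀ k c → ThinFibreAt m₀ (xPolyP k c)`, every m₀ / k / monomial support, the only escape the typed residue `Residue m₀ k c`; one PROVED Diophantine input `Ridout.padicRoth_int`; CLAIM L3031, PRICE L3032, ADDENDUM L3037, RULE K-R58, NODE L3047, VERDICT L3050) — continuation (RootDecomp1KSectorTheorem08): §10  INSPECTION BY NAME (F4 β): node 26's pencil `XP b c` (`X6P = XP 1 3`), node 23's family `M j` — 18 declarations `thinFibreAt_xLinear_sector` … `thinFibreAt_M_sector`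

(lens-1 g67 NODE 27 «THE SECTOR THEOREM BY ONE NEWTON STEP AT (∞,∞) — THE EDGE ENGINE» L3047: HOME kernel K = HOME/decomp-schanuel-lens-1/g67/lean/SectorTheorem.lean sha256 bbe43d14…, 2869 l, ONE namespace `Summit.Schanuel.Schanuel.Theorems.RootDecomp1KSectorTheorem`, imports the tree port …RootDecomp1KDigitPincer03 ONLY (node 26's record port; its closure holds every cell file used); no private / instance / set_option / notation / sorry / new axiom / binder / `decide` on levels; lens farm rc 0 · 0 errors · 0 sorries · warnings dupNamespace only, `--axioms` standard on the 18 deciding declarations, Probe rc 0 (g67/out/); memo g67/NODE-g67.md; CLAIM L3031 (ASK-FIRST under K-R57 (iii)); crit g12 PRICE L3032 (fork (A) ×0-AS-RECORD as posted / fork (B) a kernel meeting FLOOR F = «FIRST-ORDER SECTOR THEOREM» = THEOREM ×1 consuming K-R57 (iii); CHECKLIST K-g67 F1–F6 + S1–S8; RULE K-R58 PRE-ANNOUNCED) and PRICE ADDENDUM L3037 ((F6′) `W4P` by tree name; the ρ3 specimen `x² + x·Y² + Y⁵ + 3` of writer NOTE 17 L3036 = the F5 exhibit); census instruments LIVENESS-v36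 (key edge) / v37 (key ls2); crit g12 VERDICT L3050 (2026-09-02T03:35Z): THEOREM ×1 GRANTED under K-R57 (iii) for FORK (B) = the FIRST-ORDER SECTOR THEOREM AT FLOOR F (F1 F2 F3 (T) F4(α) F4(β) F5 F6 F6′ R-27-i and CHECKLIST S1–S8 met on the critic's own farm runs), the single ×1 of the sector line CONSUMED (K-R58 (i): no further ×1 on this line), TALLY lens-1 ×22 + THEOREM ×24, RULE K-R58 FIXED (PRICE L3032 (i)–(v) verbatim with the ADDENDUM L3037 gloss; W-27-2 = a ×0 wish for typed stratum predicates), PORT GO → census-1 (this port; PORT IDENTITY 27 owed by the seated critic). Port by census-1 gen 25 as `RootDecomp1KSectorTheorem01–10` (files ≤ 400 lines; `--supports stmt-Schanuel-33364`, the item stays OPEN; no census credit carried; RULE K-R58 (iv): UNCONDITIONAL PART ∪= these names): 01 = K l.1–307 of the prepped source (opens §1 / §2 / §3) — 20 decls `dMax`, `box`, `supp`, …, `two_zpow_inj`; 02 = K l.308–570 of the prepped source (opens §4) — 5 decls `far_pair`, `natDegree_le_dMax`, `norm_pow_sub_one_le`, …, `mem_supp`; 03 = K l.571–896 of the prepped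 source (opens §4b / §5) — 12 decls `layered_bound`, `edge_bound_one`, `edge_bound_crude`, …, `tendsto_partialSum_two`; 04 = K l.897–1221 of the prepped source (opens §6 / §7) — 10 decls `arch_finite`, `ridout_two`, `lt_rpow_neg_of_pow_mul_pow_lt`, …, `factorial_pred_le_div`; 05 = K l.1222–1500 of the prepped source (opens §8) — 4 decls `pair_levels_finite`, `dvd_lc_pow_val`, `den_le_of_dvd`, `den_rescaled_le`; 06 = K l.1501–1822 of the prepped source (opens §9) — 13 decls `size_regime`, `c_zero_ne_zero`, `far_levels_finite`, …, `sum_range_ite_shift`; 07 = K l.1823–2080 of the prepped source (inside §9) — 14 decls `layerPoly_lin2`, `layer0_lin2`, `layer1_lin2`, …, `natDegree_scaleShift`; 08 = K l.2081–2407 of the prepped source (opens §10) — 18 decls `thinFibreAt_xLinear_sector`, `thinFibreAt_xPolyP_one`, `edgeGood_of_gap`, …, `thinFibreAt_M_sector`; 09 = K l.2408–2633 of the prepped source (opens §11) — 17 decls `sectorCond_beta0_example`, `thinFibreAt_beta0_example`, `thinFibreAt_generic_xLinear_example`, …, `rho2_two`; 10 = K l.2634–2911 of the prepped source (opens §12)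 — 13 decls `residue_rho2`, `rho3`, `rho3_zero`, …, `W4P_eq`. 39 one-line docstrings synthesised for undocumented helper declarations (statements quoted, census port convention since gen 22); FOUR port-side `private` modifiers forced by the gate's dedup.landed lint on the first filing of part 08 (p848905): `thinFibreAt_xLinear` (≡ tree `RootDecomp1KXLinear.thinFibreAt_xLinear`, XLinear05 l.187 — K's proof kept as PRIVATE `thinFibreAt_xLinear_sector`, later uses resolve to the tree theorem via a selective open), `thinFibreAt_X6P_sector` (≡ `RootDecomp1KDigitPincer.thinFibreAt_X6P`), `xc_zero'` / `xc_three'` (≡ `RootDecomp1KDigitPincer.xc_zero` / `xc_three`), each with the reason in its docstring; everything else = K VERBATIM (statements, names, proofs, K's module docstring kept in part 01 below this provenance block).)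
-/

noncomputable section

namespace Summit.Schanuel.Schanuel.Theorems.RootDecomp1KSectorTheorem

open Polynomial LiouvilleNumber
open scoped Nat
open Summit.Schanuel.Schanuel.Theorems.RootDecomp1KTwoBaseCell (psNumer partialSum_eq_psNumer_div coprime_psNumer)
open Summit.Schanuel.Schanuel.Theorems.RootDecomp1KRelLiouvilleCell (partialSum_two_strictMono
  abs_liouvilleNumber_two_sub_partialSum)
open Summit.Schanuel.Schanuel.Theorems.RootDecomp1KDegreeLadder
open Summit.Schanuel.Schanuel.Theorems.RootDecomp1KXLinear (xLinP bev_xLinP norm_ratCast_two norm_ratCast_of_le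
  norm_psNumer_sub_one)
open Summit.Schanuel.Schanuel.Theorems.RootDecomp1KDigitPincer (xc XP X6P)
open Summit.Schanuel.Schanuel.Theorems.RootDecomp1KOddEmpty (W4P w4C vG natDegree_vG)
open Summit.Schanuel.Schanuel.Theorems.RootDecomp1KHyperellipticSiegel (mQ mC mC_zero mC_one mC_two natDegree_mQ
  coeff_mQ_five leadingCoeff_mQ)
open Summit.Schanuel.Schanuel.Theorems.RootDecomp1KXLinearII (norm_aeval_le norm_psNumer)
open Summit.Schanuel.Schanuel.Theorems.RootDecomp1KXTop
open Summit.Schanuel.Schanuel.Theorems.RootDecomp1KXAll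
open Summit.Schanuel.Schanuel.Theorems.RootDecomp1KLevelFinite
open Summit.Schanuel.Schanuel.Theorems.RootDecomp1KLocalExponent
open Summit.Schanuel.Schanuel.Theorems.RootDecomp1KIntegrality
open Summit.Schanuel.Schanuel.Theorems.RootDecomp1KXLinear (thinFibreAt_xLinear)  -- port: the tree theorem whose statement K's F4 (α) repeats (dedup.landed p848905)

/-- **F4 (α): THE `x`-LINEAR COROLLARY.**  For `A, B ∈ ℤ[Y]` with `B ≠ 0` and `deg B + 2 ≤ deg A`:
`ThinFibreAt m₀ (A(Y) + x·B(Y))` at EVERY `m₀`, with NO further hypothesis.  Route: the canonical shift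
`Y ↦ (Y + a)/b`, `a/b = (B_{e−1}/B_e − A_{d−1}/A_d)/q` (`q = d − e`; `a = −Δ₀K₀`, `b = K₀²`, `K₀ = q·A_d·B_e`,
`Δ₀ = A_{d−1}B_e − A_dB_{e−1}`) makes the pair PROPORTIONAL (`A'_{d−1}B'_e = A'_dB'_{e−1}`): then the first layer
vanishes at every non-zero edge root, all simple — branch (R) of the engine (`thinFibreAt_lin2_of_prop`) — and
TRANSPORT (T) carries the clause back.
(PORT NOTE, census-1 g25: this statement is IDENTICAL to the tree's `RootDecomp1KXLinear.thinFibreAt_xLinear`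
(RootDecomp1KXLinear05 l.187, hypothesis-free, of record) — the gate's `dedup.landed` lint forbids a public restatement
(bounce p848905 of the first filing of part 08); K's first-order proof is therefore landed under the PRIVATE name
`thinFibreAt_xLinear_sector`, and every later use of `thinFibreAt_xLinear` in this port resolves to the TREE theorem through
the selective `open … RootDecomp1KXLinear (… thinFibreAt_xLinear)` of the part headers — same statement, no text change.) -/
private theorem thinFibreAt_xLinear_sector (A B : ℤ[X]) (hB : B ≠ 0) (hdeg : B.natDegree + 2 ≤ A.natDegree) (m₀ : ℕ) :
    ThinFibreAt m₀ (xLinP A B) := by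
  classical
  obtain ⟨d, hd⟩ : ∃ d, A.natDegree = d := ⟨_, rfl⟩
  obtain ⟨e, he⟩ : ∃ e, B.natDegree = e := ⟨_, rfl⟩
  rw [hd, he] at hdeg
  have hA0 : A ≠ 0 := by
    rintro rfl
    rw [natDegree_zero] at hd
    omega
  have ha : A.coeff d ≠ 0 := by rw [← hd]; exact leadingCoeff_ne_zero.mpr hA0
  have hb : B.coeff e ≠ 0 := by rw [← he]; exact leadingCoeff_ne_zero.mpr hB
  -- the canonical shift
  obtain ⟨K₀, hK₀⟩ : ∃ K₀ : ℤ, K₀ = ((d : ℤ) - e) * A.coeff d * B.coeff e := ⟨_, rfl⟩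
  obtain ⟨Δ₀, hΔ₀⟩ : ∃ Δ₀ : ℤ, Δ₀ = A.coeff (d - 1) * B.coeff e -
    A.coeff d * (if 1 ≤ e then B.coeff (e - 1) else 0) := ⟨_, rfl⟩
  have hK₀0 : K₀ ≠ 0 := by
    rw [hK₀]
    exact mul_ne_zero (mul_ne_zero (by omega) ha) hb
  obtain ⟨b, hbdef⟩ : ∃ b : ℕ, b = K₀.natAbs * K₀.natAbs := ⟨_, rfl⟩
  obtain ⟨a, hadef⟩ : ∃ a : ℤ, a = -(Δ₀ * K₀) := ⟨_, rfl⟩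
  have hbZ : (b : ℤ) = K₀ * K₀ := by rw [hbdef]; exact Int.natAbs_mul_self' K₀
  have hb0 : b ≠ 0 := by
    rw [hbdef]
    exact mul_ne_zero (Int.natAbs_ne_zero.mpr hK₀0) (Int.natAbs_ne_zero.mpr hK₀0)
  have hb1 : 1 ≤ b := Nat.one_le_iff_ne_zero.mpr hb0
  have hshift : (b : ℤ) * Δ₀ + a * K₀ = 0 := by rw [hbZ, hadef]; ring
  -- the shifted pair
  have hA'd : (scaleShift A d a b).natDegree = d := natDegree_scaleShift A hd le_rfl hA0 a hb0
  have hB'e : (scaleShift B d a b).natDegree = e := natDegree_scaleShift B he (by omega) hB a hb0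
  have hA'lc : (scaleShift A d a b).coeff d = A.coeff d := by
    rw [coeff_scaleShift_self A hd.le le_rfl, Nat.sub_self, pow_zero, mul_one]
  have hB'lc : (scaleShift B d a b).coeff e = B.coeff e * (b : ℤ) ^ (d - e) :=
    coeff_scaleShift_self B he.le (by omega) a b
  have hB'0 : scaleShift B d a b ≠ 0 := by
    intro h
    have := congrArg (fun P : ℤ[X] => P.coeff e) h
    simp only [hB'lc, coeff_zero] at this
    exact (mul_ne_zero hb (pow_ne_zero _ (by exact_mod_cast hb0 : (b : ℤ) ≠ 0))) this
  have hA'1 : (scaleShift A d a b).coeff (d - 1) = A.coeff (d - 1) * b + A.coeff d * (a * d) := by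
    rw [coeff_scaleShift_pred A hd.le le_rfl (by omega), Nat.sub_self, zero_add, pow_one, pow_zero, mul_one]
  -- proportionality of the shifted pair
  have hprop : (scaleShift A d a b).coeff (d - 1) * (scaleShift B d a b).coeff e =
      (scaleShift A d a b).coeff d *
        (if 1 ≤ e then (scaleShift B d a b).coeff (e - 1) else 0) := by
    rw [hA'lc, hB'lc, hA'1]
    by_cases he1 : 1 ≤ e
    · rw [if_pos he1, coeff_scaleShift_pred B he.le (by omega) he1, pow_succ]
      rw [if_pos he1] at hΔ₀
      rw [hΔ₀, hK₀] at hshift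
      linear_combination (b : ℤ) ^ (d - e) * hshift
    · rw [if_neg he1, mul_zero]
      rw [if_neg he1] at hΔ₀
      have he0 : e = 0 := by omega
      subst he0
      rw [hΔ₀, hK₀] at hshift
      simp only [Nat.cast_zero, sub_zero, mul_zero] at hshift
      rw [Nat.sub_zero]
      linear_combination (b : ℤ) ^ d * hshift
  -- transport
  have hPQ : ∀ x y : ℝ, bev (xPolyP 1 (lin2 (scaleShift A d a b) (scaleShift B d a b))) x (b * y - a) =
      (b : ℝ) ^ d * bev (xLinP A B) x y := by
    intro x y
    rw [xPolyP_lin2, bev_xLinP, bev_xLinP, aeval_scaleShift A hd.le a b y, aeval_scaleShift B (by omega) a b y]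
    ring
  exact thinFibreAt_of_transport hb1 hPQ
    (thinFibreAt_lin2_of_prop _ _ hB'0 hA'd hB'e hdeg hprop m₀)

/-- F4 (α) in the `xPolyP` encoding: `c 0 = A`, `c 1 = B`. -/
theorem thinFibreAt_xPolyP_one (c : ℕ → ℤ[X]) (hB : c 1 ≠ 0) (hdeg : (c 1).natDegree + 2 ≤ (c 0).natDegree)
    (m₀ : ℕ) : ThinFibreAt m₀ (xPolyP 1 c) := by
  rw [xPolyP_one]
  exact thinFibreAt_xLinear (c 0) (c 1) hB hdeg m₀

/-! ## §10  INSPECTION BY NAME (F4 β): node 26's pencil `XP b c` (`X6P = XP 1 3`), node 23's family `M j`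
(`M 67`), the `β = 0` example, a generic `x`-linear member -/

/-- **INSPECTION LEMMA (pure gap, separable edge).**  If `S ⊇ support`, every weight of `S` is `≤ M`, no weight of
`S` lies in the open window `(M − L, M)` (the GAP is `≥ L`), the edge polynomial `f` (computed on `S`) is non-zero
with `f'(β) ≠ 0` at its non-zero roots, and `s < L`, `s < q`, then the slope `s/q` is good (branch (R), trivially:
all layers `1 … L−1` are EMPTY). -/
theorem edgeGood_of_gap (k : ℕ) (c : ℕ → ℤ[X]) (S : Finset (ℕ × ℕ)) (hS : ∀ p ∈ S, p.1 ≤ k)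
    (hsupp : ∀ p : ℕ × ℕ, p.1 ≤ k → (c p.1).coeff p.2 ≠ 0 → p ∈ S) {s q M L : ℕ}
    (hwt : ∀ p ∈ S, q * p.1 + s * p.2 ≤ M) (hgap : ∀ p ∈ S, q * p.1 + s * p.2 < M → q * p.1 + s * p.2 + L ≤ M)
    {f : ℤ[X]} (hf : layerPoly k c s q M 0 = f) (hf0 : f ≠ 0)
    (hsep : ∀ β : PadicAlgCl 2, β ≠ 0 → aeval β f = 0 → aeval β (derivative f) ≠ 0) (hsL : s < L)
    (hsq : s < q) : EdgeGood k c s q := by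
  classical
  refine ⟨M, ⟨fun p hp => hwt p (hsupp p (mem_supp hp).1 (mem_supp hp).2.2), hf ▸ hf0⟩, fun β hβ0 hroot => ?_⟩
  rw [hf] at hroot
  refine Or.inr (Or.inr ⟨by rw [hf]; exact hsep β hβ0 hroot, L, fun g hg1 hgL => ?_, hsL, hsq⟩)
  rw [layerPoly_eq_sum k c S hS hsupp, Finset.sum_eq_zero, map_zero]
  intro p hp
  exfalso
  rw [Finset.mem_filter] at hp
  have := hgap p hp.1 (by omega)
  omega

/-- `(b c : ℤ) : xc b c 0 = X ^ 7 + C c`. (PORT NOTE, census-1 g25: PRIVATE — identical to the tree's `RootDecomp1KDigitPincer.xc_zero` (RootDecomp1KDigitPincer03 l.128); `dedup.landed` bounce p848905.) -/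
private theorem xc_zero' (b c : ℤ) : xc b c 0 = X ^ 7 + C c := by simp [xc]

/-- `(b c : ℤ) : xc b c 1 = C b * X`. -/
theorem xc_one' (b c : ℤ) : xc b c 1 = C b * X := by simp [xc]

/-- `(b c : ℤ) : xc b c 2 = 0`. -/
theorem xc_two' (b c : ℤ) : xc b c 2 = 0 := by simp [xc]

/-- `(b c : ℤ) : xc b c 3 = 1`. (PORT NOTE, census-1 g25: PRIVATE — identical to the tree's `RootDecomp1KDigitPincer.xc_three` (RootDecomp1KDigitPincer03 l.125); `dedup.landed` bounce p848905.) -/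
private theorem xc_three' (b c : ℤ) : xc b c 3 = 1 := by simp [xc]

/-- `: (7 : PadicAlgCl 2) ≠ 0`. -/
theorem seven_ne_zero_st : (7 : PadicAlgCl 2) ≠ 0 := by
  have := intCast_ne_zero_st (m := 7) (by norm_num)
  exact_mod_cast this

/-- `: (5 : PadicAlgCl 2) ≠ 0`. -/
theorem five_ne_zero_st : (5 : PadicAlgCl 2) ≠ 0 := by
  have := intCast_ne_zero_st (m := 5) (by norm_num)
  exact_mod_cast this

/-- **node 26's PENCIL `XP b c = x³ + b·x·Y + Y⁷ + c`: the slope `3/7` is good for EVERY `b, c`** — support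
`⊆ {(0,7), (0,0), (1,1), (3,0)}`, weights `{21, 0, 10, 21}` (`7j + 3i`), top weight `21`, GAP `11 > s = 3`,
`q = 7 > 3`, edge polynomial `f = W⁷ + 1` (separable at `β ≠ 0`: `f' = 7W⁶`). -/
theorem edgeGood_XP (b c : ℤ) : EdgeGood 3 (xc b c) 3 7 := by
  classical
  have hS : ∀ p ∈ ({(0, 7), (0, 0), (1, 1), (3, 0)} : Finset (ℕ × ℕ)), p.1 ≤ 3 := by
    intro p hp
    simp only [Finset.mem_insert, Finset.mem_singleton] at hp
    rcases hp with rfl | rfl | rfl | rfl <;> norm_num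
  have hsupp : ∀ p : ℕ × ℕ, p.1 ≤ 3 → (xc b c p.1).coeff p.2 ≠ 0 →
      p ∈ ({(0, 7), (0, 0), (1, 1), (3, 0)} : Finset (ℕ × ℕ)) := by
    rintro ⟨j, i⟩ hj hc
    dsimp only at hj hc
    simp only [Finset.mem_insert, Finset.mem_singleton, Prod.mk.injEq]
    interval_cases j
    · rw [xc_zero', coeff_add, coeff_X_pow, coeff_C] at hc
      split_ifs at hc with h7 h0 h0
      · omega
      · exact Or.inl ⟨rfl, h7⟩
      · exact Or.inr (Or.inl ⟨rfl, h0⟩)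
      · exact (hc (by ring)).elim
    · rw [xc_one', coeff_C_mul, coeff_X] at hc
      split_ifs at hc with h1
      · exact Or.inr (Or.inr (Or.inl ⟨rfl, h1.symm⟩))
      · exact (hc (by ring)).elim
    · rw [xc_two', coeff_zero] at hc
      exact (hc rfl).elim
    · rw [xc_three', coeff_one] at hc
      split_ifs at hc with h0
      · exact Or.inr (Or.inr (Or.inr ⟨rfl, h0⟩))
      · exact (hc rfl).elim
  have h07 : (xc b c 0).coeff 7 = 1 := by
    rw [xc_zero', coeff_add, coeff_X_pow, coeff_C, if_pos rfl, if_neg (by norm_num), add_zero]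
  have h30 : (xc b c 3).coeff 0 = 1 := by rw [xc_three', coeff_one, if_pos rfl]
  have hf : layerPoly 3 (xc b c) 3 7 21 0 = X ^ 7 + 1 := by
    rw [layerPoly_eq_sum 3 (xc b c) _ hS hsupp, Finset.sum_filter, Finset.sum_insert (by decide),
      Finset.sum_insert (by decide), Finset.sum_insert (by decide), Finset.sum_singleton]
    norm_num [h07, h30]
  refine edgeGood_of_gap 3 (xc b c) _ hS hsupp (M := 21) (L := 11) ?_ ?_ hf (X_pow_add_C_ne_zero (by norm_num) 1)
    ?_ (by norm_num) (by norm_num)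
  · intro p hp
    simp only [Finset.mem_insert, Finset.mem_singleton] at hp
    rcases hp with rfl | rfl | rfl | rfl <;> norm_num
  · intro p hp
    simp only [Finset.mem_insert, Finset.mem_singleton] at hp
    rcases hp with rfl | rfl | rfl | rfl <;> norm_num
  · intro β hβ0 _
    have h : aeval β (derivative (X ^ 7 + 1 : ℤ[X])) = 7 * β ^ 6 := by
      rw [derivative_add, derivative_X_pow, derivative_one, add_zero, map_mul, map_pow, aeval_X, aeval_C]
      norm_num
    rw [h]
    exact mul_ne_zero seven_ne_zero_st (pow_ne_zero _ hβ0)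

/-- the pencil satisfies the SECTOR CONDITION at every `m₀`: its only hull pair is `(c₀, c₃)` (slope `3/7`). -/
theorem sectorCond_XP (b c : ℤ) (m₀ : ℕ) : SectorCond m₀ 3 (xc b c) := by
  have hd0 : (xc b c 0).natDegree = 7 := by rw [xc_zero']; exact natDegree_X_pow_add_C
  have hd3 : (xc b c 3).natDegree = 0 := by rw [xc_three', natDegree_one]
  have h00 : xc b c 0 ≠ 0 := by rw [xc_zero']; exact X_pow_add_C_ne_zero (by norm_num) c
  have h33 : xc b c 3 ≠ 0 := by rw [xc_three']; exact one_ne_zero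
  have hd1 : b ≠ 0 → (xc b c 1).natDegree = 1 := fun hb => by rw [xc_one']; exact natDegree_C_mul_X b hb
  have hb1 : xc b c 1 ≠ 0 → b ≠ 0 := by
    intro h hb
    apply h
    rw [xc_one', hb, map_zero, zero_mul]
  intro j₁ j₂ hlt hle h1 h2 hdlt hm hhull
  have hj₂ : j₂ = 1 ∨ j₂ = 2 ∨ j₂ = 3 := by omega
  rcases hj₂ with rfl | rfl | rfl
  · -- the pair `(0,1)` is not a hull pair: `x³` weighs more
    obtain rfl : j₁ = 0 := by omega
    have hb := hb1 h2
    have := hhull 3 le_rfl h33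
    rw [hd0, hd1 hb, hd3] at this
    omega
  · exact (h2 (xc_two' b c)).elim
  · have hj₁ : j₁ = 0 ∨ j₁ = 1 ∨ j₁ = 2 := by omega
    rcases hj₁ with rfl | rfl | rfl
    · rw [hd0, hd3]
      exact edgeGood_XP b c
    · -- the pair `(1,3)` is not a hull pair: `Y⁷` weighs more
      have hb := hb1 h1
      have := hhull 0 (by norm_num) h00
      rw [hd0, hd1 hb, hd3] at this
      omega
    · exact (h1 (xc_two' b c)).elim

/-- `(b c : ℤ) : DomZero 3 (xc b c)`. -/
theorem domZero_XP (b c : ℤ) : DomZero 3 (xc b c) := by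
  have hd0 : (xc b c 0).natDegree = 7 := by rw [xc_zero']; exact natDegree_X_pow_add_C
  intro j hj1 hj3
  rw [hd0]
  interval_cases j
  · rw [xc_one']
    exact lt_of_le_of_lt ((natDegree_C_mul_le b X).trans natDegree_X_le) (by norm_num)
  · rw [xc_two', natDegree_zero]; norm_num
  · rw [xc_three', natDegree_one]; norm_num

/-- **F4 (β): node 26's WHOLE PENCIL by the engine** (`X6P = XP 1 3`, node 25's `X5P = XP 1 2`, `X3P = XP 1 0`):
`ThinFibreAt m₀ (x³ + b·x·Y + Y⁷ + c)` at EVERY `m₀`, for EVERY `b, c ∈ ℤ` — no digit pincer, no descent. -/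
theorem thinFibreAt_XP_sector (b c : ℤ) (m₀ : ℕ) : ThinFibreAt m₀ (XP b c) :=
  thinFibreAt_of_sectorCond 3 (xc b c) (by rw [xc_three']; exact one_ne_zero) (domZero_XP b c)
    (sectorCond_XP b c m₀)

/-- node 26's standing witness `X6P = x³ + x·Y + Y⁷ + 3` by the engine. (PORT NOTE, census-1 g25: PRIVATE — the statement is
identical to the tree's `RootDecomp1KDigitPincer.thinFibreAt_X6P` (RootDecomp1KDigitPincer03 l.90); `dedup.landed` bounce p848905.) -/
private theorem thinFibreAt_X6P_sector (m₀ : ℕ) : ThinFibreAt m₀ X6P := thinFibreAt_XP_sector 1 3 m₀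

/-- **node 23's FAMILY `M j = x² + 3Y·x + (Y⁵ + 9j·Y + 9j + 3)` (`M 67 = M′ 0`): the slope `2/5` is good for
EVERY `j`** — support `⊆ {(0,5), (0,1), (0,0), (1,1), (2,0)}`, weights `{10, 2, 0, 7, 10}` (`5j + 2i`), top
weight `10`, GAP `3 > s = 2`, `q = 5 > 2`, edge polynomial `f = W⁵ + 1` (`f' = 5W⁴`). -/
theorem edgeGood_M (j : ℤ) : EdgeGood 2 (mC j) 2 5 := by
  classical
  have hS : ∀ p ∈ ({(0, 5), (0, 1), (0, 0), (1, 1), (2, 0)} : Finset (ℕ × ℕ)), p.1 ≤ 2 := by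
    intro p hp
    simp only [Finset.mem_insert, Finset.mem_singleton] at hp
    rcases hp with rfl | rfl | rfl | rfl | rfl <;> norm_num
  have hsupp : ∀ p : ℕ × ℕ, p.1 ≤ 2 → (mC j p.1).coeff p.2 ≠ 0 →
      p ∈ ({(0, 5), (0, 1), (0, 0), (1, 1), (2, 0)} : Finset (ℕ × ℕ)) := by
    rintro ⟨j', i⟩ hj hc
    dsimp only at hj hc
    simp only [Finset.mem_insert, Finset.mem_singleton, Prod.mk.injEq]
    interval_cases j'
    · rw [mC_zero, mQ, coeff_add, coeff_add, coeff_X_pow, coeff_C_mul, coeff_X, coeff_C] at hc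
      split_ifs at hc with h5 h1 h0 h0 h1 h0 h0
      · omega
      · omega
      · omega
      · exact Or.inl ⟨rfl, h5⟩
      · omega
      · exact Or.inr (Or.inl ⟨rfl, h1.symm⟩)
      · exact Or.inr (Or.inr (Or.inl ⟨rfl, h0⟩))
      · exact (hc (by ring)).elim
    · rw [mC_one, coeff_C_mul, coeff_X] at hc
      split_ifs at hc with h1
      · exact Or.inr (Or.inr (Or.inr (Or.inl ⟨rfl, h1.symm⟩)))
      · exact (hc (by ring)).elim
    · rw [mC_two, coeff_one] at hc
      split_ifs at hc with h0
      · exact Or.inr (Or.inr (Or.inr (Or.inr ⟨rfl, h0⟩)))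
      · exact (hc rfl).elim
  have h05 : (mC j 0).coeff 5 = 1 := by rw [mC_zero]; exact coeff_mQ_five j
  have h20 : (mC j 2).coeff 0 = 1 := by rw [mC_two, coeff_one, if_pos rfl]
  have hf : layerPoly 2 (mC j) 2 5 10 0 = X ^ 5 + 1 := by
    rw [layerPoly_eq_sum 2 (mC j) _ hS hsupp, Finset.sum_filter, Finset.sum_insert (by decide),
      Finset.sum_insert (by decide), Finset.sum_insert (by decide), Finset.sum_insert (by decide),
      Finset.sum_singleton]
    norm_num [h05, h20, coeff_mQ_five, mC_two, coeff_one]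
  refine edgeGood_of_gap 2 (mC j) _ hS hsupp (M := 10) (L := 3) ?_ ?_ hf (X_pow_add_C_ne_zero (by norm_num) 1)
    ?_ (by norm_num) (by norm_num)
  · intro p hp
    simp only [Finset.mem_insert, Finset.mem_singleton] at hp
    rcases hp with rfl | rfl | rfl | rfl | rfl <;> norm_num
  · intro p hp
    simp only [Finset.mem_insert, Finset.mem_singleton] at hp
    rcases hp with rfl | rfl | rfl | rfl | rfl <;> norm_num
  · intro β hβ0 _
    have h : aeval β (derivative (X ^ 5 + 1 : ℤ[X])) = 5 * β ^ 4 := by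
      rw [derivative_add, derivative_X_pow, derivative_one, add_zero, map_mul, map_pow, aeval_X, aeval_C]
      norm_num
    rw [h]
    exact mul_ne_zero five_ne_zero_st (pow_ne_zero _ hβ0)

/-- `(j : ℤ) (m₀ : ℕ) : SectorCond m₀ 2 (mC j)`. -/
theorem sectorCond_M (j : ℤ) (m₀ : ℕ) : SectorCond m₀ 2 (mC j) := by
  have hd0 : (mC j 0).natDegree = 5 := by rw [mC_zero, natDegree_mQ]
  have hd1 : (mC j 1).natDegree = 1 := by rw [mC_one]; exact natDegree_C_mul_X 3 (by norm_num)
  have hd2 : (mC j 2).natDegree = 0 := by rw [mC_two, natDegree_one]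
  have h00 : mC j 0 ≠ 0 := by rw [← leadingCoeff_ne_zero, mC_zero, leadingCoeff_mQ]; exact one_ne_zero
  have h22 : mC j 2 ≠ 0 := by rw [mC_two]; exact one_ne_zero
  intro j₁ j₂ hlt hle h1 h2 hdlt hm hhull
  have hj₂ : j₂ = 1 ∨ j₂ = 2 := by omega
  rcases hj₂ with rfl | rfl
  · obtain rfl : j₁ = 0 := by omega
    have := hhull 2 le_rfl h22
    rw [hd0, hd1, hd2] at this
    omega
  · have hj₁ : j₁ = 0 ∨ j₁ = 1 := by omega
    rcases hj₁ with rfl | rfl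
    · rw [hd0, hd2]
      exact edgeGood_M j
    · have := hhull 0 (by norm_num) h00
      rw [hd0, hd1, hd2] at this
      omega

/-- `(j : ℤ) : DomZero 2 (mC j)`. -/
theorem domZero_M (j : ℤ) : DomZero 2 (mC j) := by
  intro i hi1 hi2
  rw [mC_zero, natDegree_mQ]
  interval_cases i
  · rw [mC_one, natDegree_C_mul_X 3 (by norm_num)]; norm_num
  · rw [mC_two, natDegree_one]; norm_num

/-- **F4 (β): node 23's WHOLE FAMILY `M j = xPolyP 2 (mC j)` by the engine** (`M 67 = M′ 0` included) — without
`hyperellipticSiegel`: `ThinFibreAt m₀ (M j)` at EVERY `m₀`, EVERY `j ∈ ℤ`. -/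
theorem thinFibreAt_M_sector (j : ℤ) (m₀ : ℕ) : ThinFibreAt m₀ (xPolyP 2 (mC j)) :=
  thinFibreAt_of_sectorCond 2 (mC j) (by rw [mC_two]; exact one_ne_zero) (domZero_M j) (sectorCond_M j m₀)

end Summit.Schanuel.Schanuel.Theorems.RootDecomp1KSectorTheorem
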